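import Literature.Probability.RandomPlanarGeometry.SAWUnfoldingTwoSided
import Literature.Probability.RandomPlanarGeometry.HammersleyWelshBound
import Literature.Probability.RandomPlanarGeometry.SquaredWalksFromRectangles
import Literature.Probability.RandomPlanarGeometry.SupercriticalSAWProp3
import HarnessLib

/-!
# Discharge of Lemma 5 and Proposition 3 of Duminil-Copin–Kozma–Yadin 2014

Topic `Literature/Probability/RandomPlanarGeometry`. This file closes the lower chain of the proof
DAG of Theorem 1 of H. Duminil-Copin, G. Kozma, A. Yadin, *Supercritical self-avoiding walks are
space-filling* (2014) (`Literature.Barriers.CriticalPhenomena.SupercriticalSAW.DKY2014_thm1`):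

* `rectangleWalkCount_eq_card_rectangleFuns` — the Walk-model rectangle walks `Σₙ` of
  `SquaredWalksFromRectangles.lean` are the vertex-function rectangle walks of
  `SAWUnfoldingTwoSided.lean` (`Walk.getVert`);
* **`DKY2014_lem5_step1_bridge_holds`** — `#Σₙ ≥ e^{-6√n} bₙ` (the printed Step 1 of the proof
  of Lemma 5, by the two-sided unfolding `Zd.card_bridges_le_exp_mul_card_rectangleFuns`);
* **`DKY2014_lem5_step1_holds`**, **`DKY2014_lem5_holds`** (Lemma 5: `aₙ ≥ μⁿ e^{-c√n}`, `n`
  even) and **`DKY2014_prop3_holds`** (Proposition 3: `limsup_m Z_m(x) = ∞` for `x > 1/μ`), by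
  the proved reductions `DKY2014_lem5_step1_of_bridge` (with `DKY2014_eq21_holds`, the
  Hammersley–Welsh bound), `DKY2014_lem5_of_step1` and `DKY2014_prop3_of_lem5`.

After this file the named fact `SupercriticalSAWSpaceFilling` (= `DKY2014_thm1`) rests, through
`DKY2014_thm1_of_thm6_disk`, on the single named fact `DKY2014_thm6_disk` (Theorem 6 of the
source for the disk: the Peierls estimate via Proposition 7's polygon-insertion surgery).
-/

noncomputable section

open Finset Literature.Probability.LatticeModels Literature.Probability.Percolation SimpleGraph
open scoped BigOperators

namespace Literature.Probability.RandomPlanarGeometry.SAW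

/-! ### The two models of rectangle walks agree -/

open Classical in
/-- The vertex function of an `n`-step rectangle walk to `v` is a vertex-function rectangle
walk to `v`, and conversely; termwise equinumerosity. [cite: DuminilCopinKozmaYadin2014, Lemma 5 (proof, Step 1: definition of Σₙ)] -/
theorem card_filter_isRectangleWalk_eq (n : ℕ) (v : Site 2) :
    (((zdGraph 2).finsetWalkLength n (0 : Site 2) v).filter fun p => IsRectangleWalk p).card =
      ((Zd.sawFun 2 n v).filter fun ω => ∀ i ≤ n, ∀ j, 0 ≤ ω i j ∧ ω i j ≤ ω n j).card := by
  classical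
  refine Finset.card_nbij (fun p : (zdGraph 2).Walk (0 : Site 2) v => p.getVert) (fun p hp => ?_)
    (fun p hp q hq h => ?_) (fun ω hω => ?_)
  · rw [Finset.mem_coe, Finset.mem_filter, mem_finsetWalkLength_iff] at hp
    obtain ⟨hlen, hpath, hrect⟩ := hp
    rw [Finset.mem_coe, Finset.mem_filter]
    refine ⟨?_, fun i hi j => ?_⟩
    · rw [Zd.sawFun, Finset.mem_image]
      exact ⟨p, Finset.mem_filter.2 ⟨mem_finsetWalkLength_iff.2 hlen, hpath⟩, rfl⟩
    · change 0 ≤ p.getVert i j ∧ p.getVert i j ≤ p.getVert n j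
      rw [p.getVert_of_length_le (hlen ▸ le_rfl : p.length ≤ n)]
      exact hrect _ (p.getVert_mem_support i) j
  · exact Walk.ext_getVert (congrFun h)
  · rw [Finset.mem_coe, Finset.mem_filter] at hω
    obtain ⟨hω, hrect⟩ := hω
    have hω' := hω
    rw [Zd.sawFun, Finset.mem_image] at hω'
    obtain ⟨p, hp, rfl⟩ := hω'
    rw [Finset.mem_filter, mem_finsetWalkLength_iff] at hp
    refine ⟨p, ?_, rfl⟩
    rw [Finset.mem_coe, Finset.mem_filter, mem_finsetWalkLength_iff]
    refine ⟨hp.1, hp.2, fun w hw i => ?_⟩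
    rw [Walk.mem_support_iff_exists_getVert] at hw
    obtain ⟨k, rfl, hk⟩ := hw
    have := hrect k (hp.1 ▸ hk) i
    rwa [p.getVert_of_length_le (hp.1 ▸ le_rfl : p.length ≤ n)] at this

/-- **The two models of rectangle walks agree**: `rectangleWalkCount n = #(Zd.rectangleFuns n)`.
[cite: DuminilCopinKozmaYadin2014, Lemma 5 (proof, Step 1: definition of Σₙ)] -/
theorem rectangleWalkCount_eq_card_rectangleFuns (n : ℕ) :
    rectangleWalkCount n = (Zd.rectangleFuns n).card := by
  classical
  have hdisj : (↑(box 2 n) : Set (Site 2)).PairwiseDisjoint fun x =>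
      (Zd.sawFun 2 n x).filter fun ω => ∀ i ≤ n, ∀ j, 0 ≤ ω i j ∧ ω i j ≤ ω n j := by
    intro x _ y _ hxy
    refine Finset.disjoint_left.2 fun ω hx hy => hxy ?_
    have hx' := (Zd.mem_sawFun.1 (Finset.mem_filter.1 hx).1).2.1 n le_rfl
    have hy' := (Zd.mem_sawFun.1 (Finset.mem_filter.1 hy).1).2.1 n le_rfl
    exact hx'.symm.trans hy'
  rw [Zd.rectangleFuns, Zd.saws, Finset.filter_biUnion, Finset.card_biUnion hdisj]
  unfold rectangleWalkCount
  exact Finset.sum_congr rfl fun v _ => card_filter_isRectangleWalk_eq n v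

/-! ### Step 1, Lemma 5 and Proposition 3 -/

/-- **Discharge of `DKY2014_lem5_step1_bridge`**: `#Σₙ ≥ e^{-6√n} bₙ` (the two-sided unfolding of a
bridge into the rectangle spanned by its endpoints is at most `e^{6√n}`-to-one).
[cite: DuminilCopinKozmaYadin2014, Lemma 5 (proof, Step 1)] -/
theorem DKY2014_lem5_step1_bridge_holds : DKY2014_lem5_step1_bridge := by
  refine ⟨6, fun n => ?_⟩
  have h := Zd.card_bridges_le_exp_mul_card_rectangleFuns n
  rw [← bridgeCount_eq_zd, ← rectangleWalkCount_eq_card_rectangleFuns] at h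
  rw [Real.exp_neg, inv_mul_le_iff₀ (Real.exp_pos _)]
  exact h

/-- **Discharge of `DKY2014_lem5_step1`** (Step 1 of the printed proof of Lemma 5:
`#Σₙ ≥ e^{-c√n} μⁿ`). [cite: DuminilCopinKozmaYadin2014, Lemma 5 (proof, Step 1)] -/
theorem DKY2014_lem5_step1_holds : DKY2014_lem5_step1 :=
  DKY2014_lem5_step1_of_bridge DKY2014_lem5_step1_bridge_holds DKY2014_eq21_holds

/-- **Discharge of Lemma 5 of Duminil-Copin–Kozma–Yadin 2014**: "For `c` sufficiently large and
`n` even, the number `aₙ` of squared walks of length `n` satisfies `aₙ ≥ μⁿ e^{-c√n}`."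
[cite: DuminilCopinKozmaYadin2014, Lemma 5] -/
theorem DKY2014_lem5_holds : DKY2014_lem5 :=
  DKY2014_lem5_of_step1 DKY2014_lem5_step1_holds

/-- **Discharge of Proposition 3 of Duminil-Copin–Kozma–Yadin 2014**: "For `x > 1/μ`, we have
`limsup_{m→∞} Z_m(x) = ∞`." [cite: DuminilCopinKozmaYadin2014, Proposition 3] -/
theorem DKY2014_prop3_holds : DKY2014_prop3 :=
  DKY2014_prop3_of_lem5 DKY2014_lem5_holds

end Literature.Probability.RandomPlanarGeometry.SAW
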